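import Literature.NumberTheory.GelbartRogawski1991.LocalDoubledUnitarySplitMixedModel
import Literature.RepresentationTheory.HeisenbergGroup.SchrodingerUnramifiedVector
import HarnessLib

/-!
# The Weyl ∕ Fourier operator twin: an implementer of `h` with `E h E⁻¹ = J_𝕋^{±1}` is `γ · Γ⁻¹ 𝓕^{±1} Γ`
# ([Weil1964, n° 13 (29), n° 34]; [MoeglinVignerasWaldspurger1987, Chap. 2 II.1 (A), II.6]; [Rangarao1993, Lemma 3.2 (3.9)])

Topic `NumberTheory/GelbartRogawski1991` (with a generic §1 in namespace `Literature.RepresentationTheory.HeisenbergGroup`);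
§2 in namespace `Literature.NumberTheory.GelbartRogawski1991.UnitaryDualPair.LocalSplitting`. KERNEL ONLY: theorems;
no definition, no named fact, no `sorry`.

This is the Weyl-element companion ("(J1b) WEYL ∕ FOURIER OPERATOR TWIN") of the Levi lemma
`leraySection_deltaLagrangian_apply_eq_conj_leviOpPi` (`LocalDoubledUnitarySplitMixedModel` §1) and of its unipotent
twin. SETTING: the local smooth Schrödinger model `ρ_𝕋 = localSchrodinger F N T v = schrodingerSB β_𝕋 ψ_v` of
`H(𝕎_v)`, `𝕎_v = F_vᴺ × F_vᴺ`, `β_𝕋(x, y) = ⟨x, 𝕋_v y⟩` — a GRAM model (`𝕋_v ≠ 1` in general), NOT the standard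
duality `⟨x, y⟩` of `SchrodingerPiOperators` ∕ `SchrodingerLeraySectionParabolic`. Through the isomorphism of
Heisenberg data `e_𝕋 : (x, y) ↦ (x, 𝕋 y)` (`gramProd`, `ρ_𝕋 = ρ_1 ∘ e_𝕋`, `schrodingerSB_gram_eq`) the transported
Weyl element `J_𝕋 := transportSp 𝕋 J : (x, y) ↦ (−𝕋 y, 𝕋⁻¹ x)` (`transportSp_J`; the token of
`symJ_mul_splitDarboux_gramD_eq`) becomes the INVERSE of the standard Weyl element `(x, y) ↦ (y, −x)`
(`symplecticConj_gramProd_weyl`), which the self-dual Fourier operator `𝓕 = fourierOpPi μ hψ hm` implements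
(`weyl_fourierOpPi_mem_MpPsi`). Hence:

* §1 (generic) `implements_transportSp_symJ_fourierOpPi_inv` ∕ `implements_transportSp_symJ_inv_fourierOpPi`:
  **in the Gram model `ρ_T`, `𝓕⁻¹` implements `J_T` and `𝓕` implements `J_T⁻¹`** — for the SAME character `ψ` as
  the model, ANY Haar measure `μ` and ANY conductor exponent `m` (no self-duality needed); and the model-free
  conjugation principle `exists_smul_eq_conj_of_implements_conj`: **if `Γ` implements `E`, `M` implements
  `E h E⁻¹` and `R` implements `h`, then `R = γ • Γ⁻¹ M Γ` for a unit `γ`** (implementers are unique up to scalars,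
  [MoeglinVignerasWaldspurger1987] Chap. 2 II.1 (A)).
* §2 (the local unitary ∕ doubled setting, binders of the Levi lemma) `implementer_apply_eq_smul_conj_fourierOpPi`:
  for `h, E ∈ Sp(𝕎_v)`, `Γ` an implementer of `E`, `R` an implementer of `h` (e.g. `R = r(h)` for ANY implementer
  section `r`, in particular Rao's `r_Δ` of a `LocalSplittingDatum`, `leraySection_deltaLagrangian_apply_eq_smul_conj_fourierOpPi`)
  and **`E h E⁻¹ = J_𝕋⁻¹`: `R Φ = γ • Γ⁻¹ (𝓕 (Γ Φ))` for some `γ ∈ ℂˣ`**; the orientation `E h E⁻¹ = J_𝕋` gives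
  `𝓕⁻¹` (`…_fourierOpPi_symm`), and the mixed words `J_𝕋⁻¹ m(B)`, `m(B) J_𝕋⁻¹` give `𝓕 ∘ leviOpPi B`,
  `leviOpPi B ∘ 𝓕` (`…_fourierOpPi_leviOpPi`, `…_leviOpPi_fourierOpPi`); finally the Weil-representation form
  `LocalSplittingDatum.localOmega_apply_eq_smul_conj_fourierOpPi`: `ω_D(g) Φ = γ • Γ⁻¹ (𝓕 (Γ Φ))` whenever
  `E ι_v(g) E⁻¹ = J_𝕋⁻¹`.

WHY ONLY UP TO A SCALAR. Unlike the Levi ∕ unipotent twins, the Weyl element fixes NEITHER the Lagrangian `ℓ` of the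
Leray normalisation of `r` NOR `E⁻¹ ℓ_Y`, so `leraySection_apply_eq_of_map_eq` (two Leray sections agree on a common
stabiliser) does not apply and the value `r(h)` is pinned only up to a Weil-index constant; the consumer
(`MoeglinVignerasWaldspurger1987.functional_eq_zero_of_forall_unipOpPi_eq_of_fourierOpPi`, "a tempered functional
invariant under `n(b • c)` and an eigenvector of `𝓕` for ANY eigenvalue `γ` vanishes") takes an arbitrary `γ`, so the
scalar is left free here on purpose.

Written for line LD2 (`LTC₁` by the soft road, organ (Z) `AnisotropicPlaneCentreTypeVanishes`, slot (J1b)) of the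
cell `hodgecm-mathlib`; count-neutral (`--supports stmt-HodgeConjecture-24832`); nothing here is a claim of
[Liu2021]. HC_CM is proved only modulo the printed citations until rung 0 of the ladder closes.

## References

* A. Weil, *Sur certains groupes d'opérateurs unitaires*, Acta Math. 111 (1964) 143–211: n° 13 (29), p. 160 (the
  operator of the Weyl element is the Fourier transform); n° 34, p. 182 (change of duality) [Weil1964].
* C. Mœglin, M.-F. Vignéras, J.-L. Waldspurger, *Correspondances de Howe sur un corps p-adique*, LNM 1291 (1987),
  Chap. 2 II.1 (A) ("M est unique à un scalaire près"), II.6 [MoeglinVignerasWaldspurger1987].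
* R. Ranga Rao, *On some explicit formulas in the theory of Weil representation*, Pacific J. Math. 157 (1993)
  335–371: Lemma 3.2 (3.9), p. 351 [Rangarao1993].
-/

set_option autoImplicit false

noncomputable section

/-! ## §1 Generic: the Fourier operator in a Gram model; conjugation of implementers -/

namespace Literature.RepresentationTheory.HeisenbergGroup

open _root_.MeasureTheory Matrix
open Literature.NumberTheory.Automorphic
open Literature.NumberTheory.GaloisRepresentations.IsNonarchimedeanLocalField
open SymplecticMatrix

/-! ### §1.1 `Γ` implements `E`, `M` implements `E h E⁻¹` ⇒ `Γ⁻¹ M Γ` implements `h`; hence `R = γ • Γ⁻¹ M Γ` -/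

section Conj

variable {R : Type*} [CommRing R] [Invertible (2 : R)] {V : Type*} [AddCommGroup V] [Module R V]
  {B : V →ₗ[R] V →ₗ[R] R} {k : Type*} [Field k] {S : Type*} [AddCommGroup S] [Module k S]
  (ρ : Representation k (Heisenberg B) S)

/-- **conjugating an implementer**: if `Γ` implements `E` and `M` implements `E h E⁻¹` (condition (A) of MVW for the
model `ρ`), then `Γ⁻¹ M Γ` implements `E⁻¹ (E h E⁻¹) E = h`. [cite: MoeglinVignerasWaldspurger1987, Chap. 2 II.1 (A)] -/
theorem implements_inv_mul_mul_of_implements_conj {E' h : symplecticGroup B} {Γ M : S ≃ₗ[k] S}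
    (hΓ : Implements ρ (ofSymplectic B E') Γ) (hM : Implements ρ (ofSymplectic B (E' * h * E'⁻¹)) M) :
    Implements ρ (ofSymplectic B h) (Γ⁻¹ * M * Γ) := by
  have key := Implements.mul ρ (Implements.mul ρ (Implements.inv ρ hΓ) hM) hΓ
  rw [← map_inv, ← _root_.map_mul, ← _root_.map_mul] at key
  have e : E'⁻¹ * (E' * h * E'⁻¹) * E' = h := by group
  rwa [e] at key

/-- **THE CONJUGATION PRINCIPLE FOR IMPLEMENTERS.** Let implementers of `ρ` be unique up to scalars
(`ImplementerUniqueUpToScalar ρ`, MVW II.1 (A)). If `Γ` implements `E`, `M` implements `E h E⁻¹` and `R` implements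
`h`, then there is a unit `γ` with `R f = γ • Γ⁻¹ (M (Γ f))` for every `f` — `R` and `Γ⁻¹ M Γ` both implement `h`.
[cite: MoeglinVignerasWaldspurger1987, Chap. 2 II.1 (A)] -/
theorem exists_smul_eq_conj_of_implements_conj (hU : ImplementerUniqueUpToScalar ρ)
    {E' h : symplecticGroup B} {R' Γ M : S ≃ₗ[k] S} (hR : Implements ρ (ofSymplectic B h) R')
    (hΓ : Implements ρ (ofSymplectic B E') Γ) (hM : Implements ρ (ofSymplectic B (E' * h * E'⁻¹)) M) :
    ∃ γ : kˣ, ∀ f : S, R' f = (γ : k) • Γ.symm (M (Γ f)) := by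
  obtain ⟨γ, hγ⟩ := hU h (Γ⁻¹ * M * Γ) R' (implements_inv_mul_mul_of_implements_conj ρ hΓ hM) hR
  refine ⟨γ, fun f => ?_⟩
  rw [hγ f, LinearEquiv.mul_apply, LinearEquiv.mul_apply, LinearEquiv.coe_inv]

end Conj

/-! ### §1.2 In the Gram model `ρ_T`, `𝓕⁻¹` implements `J_T = transportSp T J` and `𝓕` implements `J_T⁻¹` -/

section Gram

variable {F : Type*} [Field F] [ValuativeRel F] [TopologicalSpace F] [IsNonarchimedeanLocalField F]
  {ι : Type*} [Fintype ι] [DecidableEq ι] [Invertible (2 : F)] (T : Matrix ι ι F) (hT : IsUnit T.det)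
  {ψ : AddChar F Circle} (hl : IsLocallyConstant (⇑ψ : F → Circle))
  (hbT : ∀ y : ι → F, Continuous fun u : ι → F => Matrix.toLinearMap₂' F T u y)
  [MeasurableSpace F] [BorelSpace F] (μ : Measure F) [μ.IsAddHaarMeasure] {m : ℤ}

/-- **`𝓕⁻¹` implements the transported Weyl element `J_T : (x, y) ↦ (−T y, T⁻¹ x)` in the Gram model
`ρ_T = schrodingerSB β_T ψ`** (for the SAME `ψ`, any Haar `μ`, any conductor exponent): through `e_T : (x, y) ↦ (x, T y)`
the element `J_T` is the inverse of the standard Weyl element `(x, y) ↦ (y, −x)`, implemented by the Fourier operator.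
[cite: Weil1964, n° 13 (29), p. 160, n° 34, p. 182; MoeglinVignerasWaldspurger1987, Chap. 2 II.6] -/
theorem implements_transportSp_symJ_fourierOpPi_inv (hψ : ψ.IsContinuousNontrivial) (hm : ψ.HasConductorExp m) :
    Implements (schrodingerSB (Matrix.toLinearMap₂' F T) ψ hl hbT)
      (ofSymplectic _ (transportSp T hT (SymplecticGroup.symJ ι F))) (fourierOpPi μ hψ hm)⁻¹ := by
  have hF : Implements (schrodingerSB (dotProductBilin F F (m := ι)) ψ hl continuous_dotProductBilin_left)
      (ofSymplectic _ (weylSp (dotProductBilin F F (m := ι)) (LinearEquiv.refl F (ι → F)) (LinearEquiv.neg F)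
        dotProductBilin_refl_neg')⁻¹) (fourierOpPi μ hψ hm)⁻¹ := by
    rw [map_inv]
    exact Implements.inv _ ((mem_MpPsi _ _).1 (weyl_fourierOpPi_mem_MpPsi hl continuous_dotProductBilin_left μ hψ hm))
  rw [← symplecticConj_gramProd_weyl T hT, ← transportSp_J] at hF
  exact (implements_iff_implements_symplecticConj (gramProd T hT) (polar_dotProductBilin_gramProd T hT)
    (schrodingerSB_gram_eq T hT hl continuous_dotProductBilin_left hbT (ψ := ψ)) _ _).2 hF

/-- **`𝓕` implements `J_T⁻¹ : (x, y) ↦ (T y, −T⁻¹ x)` in the Gram model `ρ_T`.**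
[cite: Weil1964, n° 13 (29), p. 160, n° 34, p. 182; MoeglinVignerasWaldspurger1987, Chap. 2 II.6] -/
theorem implements_transportSp_symJ_inv_fourierOpPi (hψ : ψ.IsContinuousNontrivial) (hm : ψ.HasConductorExp m) :
    Implements (schrodingerSB (Matrix.toLinearMap₂' F T) ψ hl hbT)
      (ofSymplectic _ (transportSp T hT (SymplecticGroup.symJ ι F))⁻¹) (fourierOpPi μ hψ hm) := by
  have h := Implements.inv _ (implements_transportSp_symJ_fourierOpPi_inv T hT hl hbT μ hψ hm)
  rwa [inv_inv, ← map_inv] at h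

/-- the mixed word: **`𝓕 ∘ leviOpPi (x ↦ B x)` implements `J_T⁻¹ m(B)`** (`m(B) = transportSp T (levi B)` the
transported Siegel Levi element, implemented by the normalised Levi operator).
[cite: Weil1964, n° 13 (29), p. 160; MoeglinVignerasWaldspurger1987, Chap. 2 II.6] -/
theorem implements_transportSp_symJ_inv_mul_levi_fourierOpPi_mul_leviOpPi (hψ : ψ.IsContinuousNontrivial)
    (hm : ψ.HasConductorExp m) (B' : GL ι F) :
    Implements (schrodingerSB (Matrix.toLinearMap₂' F T) ψ hl hbT)
      (ofSymplectic _ ((transportSp T hT (SymplecticGroup.symJ ι F))⁻¹ * transportSp T hT (levi B')))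
      (fourierOpPi μ hψ hm * leviOpPi (glEquiv B')) := by
  rw [_root_.map_mul]
  exact Implements.mul _ (implements_transportSp_symJ_inv_fourierOpPi T hT hl hbT μ hψ hm)
    (implements_transportSp_levi_leviOpPi T hT hl hbT B')

/-- the other mixed word: **`leviOpPi (x ↦ B x) ∘ 𝓕` implements `m(B) J_T⁻¹`**.
[cite: Weil1964, n° 13 (29), p. 160; MoeglinVignerasWaldspurger1987, Chap. 2 II.6] -/
theorem implements_levi_mul_transportSp_symJ_inv_leviOpPi_mul_fourierOpPi (hψ : ψ.IsContinuousNontrivial)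
    (hm : ψ.HasConductorExp m) (B' : GL ι F) :
    Implements (schrodingerSB (Matrix.toLinearMap₂' F T) ψ hl hbT)
      (ofSymplectic _ (transportSp T hT (levi B') * (transportSp T hT (SymplecticGroup.symJ ι F))⁻¹))
      (leviOpPi (glEquiv B') * fourierOpPi μ hψ hm) := by
  rw [_root_.map_mul]
  exact Implements.mul _ (implements_transportSp_levi_leviOpPi T hT hl hbT B')
    (implements_transportSp_symJ_inv_fourierOpPi T hT hl hbT μ hψ hm)

end Gram

end Literature.RepresentationTheory.HeisenbergGroup

/-! ## §2 The local unitary ∕ doubled setting: `E h E⁻¹ = J_𝕋^{±1}` ⇒ `R = γ • Γ⁻¹ 𝓕^{±1} Γ` -/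

open NumberField IsDedekindDomain MeasureTheory Matrix
open Literature.RepresentationTheory.HeisenbergGroup Literature.RepresentationTheory.HeisenbergGroup.SymplecticMatrix
open Literature.NumberTheory.Automorphic Literature.NumberTheory.Automorphic.UnitaryGroup Literature.NumberTheory.Weil1964
open Literature.NumberTheory.GaloisRepresentations.IsNonarchimedeanLocalField

namespace Literature.NumberTheory.GelbartRogawski1991.UnitaryDualPair.LocalSplitting

variable (F : Type) [Field F] [NumberField F] (N : ℕ) (T : Matrix (Fin N) (Fin N) F)
  (v : HeightOneSpectrum (𝓞 F))
  [MeasurableSpace (v.adicCompletion F)] [BorelSpace (v.adicCompletion F)]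
  (μ : Measure (v.adicCompletion F)) [μ.IsAddHaarMeasure]
  (hTv : IsUnit (localGram F N T v).det)

/-- **THE WEYL ∕ FOURIER OPERATOR TWIN.** In the local Schrödinger model `ρ_𝕋 = localSchrodinger F N T v` (implementers
unique up to scalars, `hU`), let `Γ` implement `E ∈ Sp(𝕎_v)`, `R` implement `h ∈ Sp(𝕎_v)`, and suppose
`E h E⁻¹ = J_𝕋⁻¹` with `J_𝕋 = transportSp 𝕋_v J : (x, y) ↦ (−𝕋 y, 𝕋⁻¹ x)` the transported Weyl element. Then for
some `γ ∈ ℂˣ`: `R Φ = γ • Γ⁻¹ (𝓕 (Γ Φ))` for all `Φ`, `𝓕 = fourierOpPi μ` the Fourier operator of `ψ_v` (any Haar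
`μ`, any conductor exponent `m`). [cite: Weil1964, n° 13 (29), p. 160; MoeglinVignerasWaldspurger1987, Chap. 2 II.1 (A), II.6] -/
theorem implementer_apply_eq_smul_conj_fourierOpPi (hU : ImplementerUniqueUpToScalar (localSchrodinger F N T v))
    {h E' : LocalSp F N T v}
    {R Γ : SchwartzBruhat (Fin N → v.adicCompletion F) ≃ₗ[ℂ] SchwartzBruhat (Fin N → v.adicCompletion F)}
    (hR : Implements (localSchrodinger F N T v) (ofSymplectic _ h) R)
    (hΓ : Implements (localSchrodinger F N T v) (ofSymplectic _ E') Γ)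
    (hW : E' * h * E'⁻¹ = (transportSp (localGram F N T v) hTv (SymplecticGroup.symJ _ _))⁻¹)
    {m : ℤ} (hm : (adeleAddCharAt F v).HasConductorExp m) :
    ∃ γ : ℂˣ, ∀ Φ : SchwartzBruhat (Fin N → v.adicCompletion F),
      R Φ = (γ : ℂ) • Γ.symm (fourierOpPi μ (isContinuousNontrivial_adeleAddCharAt F v) hm (Γ Φ)) := by
  have hψ := isContinuousNontrivial_adeleAddCharAt F v
  refine exists_smul_eq_conj_of_implements_conj (localSchrodinger F N T v) hU hR hΓ ?_
  rw [hW]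
  exact implements_transportSp_symJ_inv_fourierOpPi (localGram F N T v) hTv
    (isLocallyConstant_of_isContinuousNontrivial hψ) (continuous_toLinearMap₂'_left (localGram F N T v)) μ hψ hm

/-- the opposite orientation: **`E h E⁻¹ = J_𝕋` ⇒ `R Φ = γ • Γ⁻¹ (𝓕⁻¹ (Γ Φ))`.**
[cite: Weil1964, n° 13 (29), p. 160; MoeglinVignerasWaldspurger1987, Chap. 2 II.1 (A), II.6] -/
theorem implementer_apply_eq_smul_conj_fourierOpPi_symm (hU : ImplementerUniqueUpToScalar (localSchrodinger F N T v))
    {h E' : LocalSp F N T v}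
    {R Γ : SchwartzBruhat (Fin N → v.adicCompletion F) ≃ₗ[ℂ] SchwartzBruhat (Fin N → v.adicCompletion F)}
    (hR : Implements (localSchrodinger F N T v) (ofSymplectic _ h) R)
    (hΓ : Implements (localSchrodinger F N T v) (ofSymplectic _ E') Γ)
    (hW : E' * h * E'⁻¹ = transportSp (localGram F N T v) hTv (SymplecticGroup.symJ _ _))
    {m : ℤ} (hm : (adeleAddCharAt F v).HasConductorExp m) :
    ∃ γ : ℂˣ, ∀ Φ : SchwartzBruhat (Fin N → v.adicCompletion F),
      R Φ = (γ : ℂ) • Γ.symm ((fourierOpPi μ (isContinuousNontrivial_adeleAddCharAt F v) hm).symm (Γ Φ)) := by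
  have hψ := isContinuousNontrivial_adeleAddCharAt F v
  obtain ⟨γ, hγ⟩ := exists_smul_eq_conj_of_implements_conj (localSchrodinger F N T v) hU hR hΓ (by
    rw [hW]
    exact implements_transportSp_symJ_fourierOpPi_inv (localGram F N T v) hTv
      (isLocallyConstant_of_isContinuousNontrivial hψ) (continuous_toLinearMap₂'_left (localGram F N T v)) μ hψ hm)
  exact ⟨γ, fun Φ => by rw [hγ Φ, LinearEquiv.coe_inv]⟩

/-- the mixed word **`E h E⁻¹ = J_𝕋⁻¹ m(B)` ⇒ `R Φ = γ • Γ⁻¹ (𝓕 (leviOpPi (x ↦ B x) (Γ Φ)))`.**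
[cite: Weil1964, n° 13 (29), p. 160; MoeglinVignerasWaldspurger1987, Chap. 2 II.1 (A), II.6] -/
theorem implementer_apply_eq_smul_conj_fourierOpPi_leviOpPi
    (hU : ImplementerUniqueUpToScalar (localSchrodinger F N T v)) {h E' : LocalSp F N T v}
    {R Γ : SchwartzBruhat (Fin N → v.adicCompletion F) ≃ₗ[ℂ] SchwartzBruhat (Fin N → v.adicCompletion F)}
    (hR : Implements (localSchrodinger F N T v) (ofSymplectic _ h) R)
    (hΓ : Implements (localSchrodinger F N T v) (ofSymplectic _ E') Γ) (B' : GL (Fin N) (v.adicCompletion F))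
    (hW : E' * h * E'⁻¹ = (transportSp (localGram F N T v) hTv (SymplecticGroup.symJ _ _))⁻¹ *
      transportSp (localGram F N T v) hTv (levi B'))
    {m : ℤ} (hm : (adeleAddCharAt F v).HasConductorExp m) :
    ∃ γ : ℂˣ, ∀ Φ : SchwartzBruhat (Fin N → v.adicCompletion F),
      R Φ = (γ : ℂ) • Γ.symm (fourierOpPi μ (isContinuousNontrivial_adeleAddCharAt F v) hm
        (leviOpPi (glEquiv B') (Γ Φ))) := by
  have hψ := isContinuousNontrivial_adeleAddCharAt F v
  obtain ⟨γ, hγ⟩ := exists_smul_eq_conj_of_implements_conj (localSchrodinger F N T v) hU hR hΓ (by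
    rw [hW]
    exact implements_transportSp_symJ_inv_mul_levi_fourierOpPi_mul_leviOpPi (localGram F N T v) hTv
      (isLocallyConstant_of_isContinuousNontrivial hψ) (continuous_toLinearMap₂'_left (localGram F N T v)) μ hψ hm B')
  exact ⟨γ, fun Φ => by rw [hγ Φ, LinearEquiv.mul_apply]⟩

/-- the mixed word **`E h E⁻¹ = m(B) J_𝕋⁻¹` ⇒ `R Φ = γ • Γ⁻¹ (leviOpPi (x ↦ B x) (𝓕 (Γ Φ)))`.**
[cite: Weil1964, n° 13 (29), p. 160; MoeglinVignerasWaldspurger1987, Chap. 2 II.1 (A), II.6] -/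
theorem implementer_apply_eq_smul_conj_leviOpPi_fourierOpPi
    (hU : ImplementerUniqueUpToScalar (localSchrodinger F N T v)) {h E' : LocalSp F N T v}
    {R Γ : SchwartzBruhat (Fin N → v.adicCompletion F) ≃ₗ[ℂ] SchwartzBruhat (Fin N → v.adicCompletion F)}
    (hR : Implements (localSchrodinger F N T v) (ofSymplectic _ h) R)
    (hΓ : Implements (localSchrodinger F N T v) (ofSymplectic _ E') Γ) (B' : GL (Fin N) (v.adicCompletion F))
    (hW : E' * h * E'⁻¹ = transportSp (localGram F N T v) hTv (levi B') *
      (transportSp (localGram F N T v) hTv (SymplecticGroup.symJ _ _))⁻¹)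
    {m : ℤ} (hm : (adeleAddCharAt F v).HasConductorExp m) :
    ∃ γ : ℂˣ, ∀ Φ : SchwartzBruhat (Fin N → v.adicCompletion F),
      R Φ = (γ : ℂ) • Γ.symm (leviOpPi (glEquiv B')
        (fourierOpPi μ (isContinuousNontrivial_adeleAddCharAt F v) hm (Γ Φ))) := by
  have hψ := isContinuousNontrivial_adeleAddCharAt F v
  obtain ⟨γ, hγ⟩ := exists_smul_eq_conj_of_implements_conj (localSchrodinger F N T v) hU hR hΓ (by
    rw [hW]
    exact implements_levi_mul_transportSp_symJ_inv_leviOpPi_mul_fourierOpPi (localGram F N T v) hTv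
      (isLocallyConstant_of_isContinuousNontrivial hψ) (continuous_toLinearMap₂'_left (localGram F N T v)) μ hψ hm B')
  exact ⟨γ, fun Φ => by rw [hγ Φ, LinearEquiv.mul_apply]⟩

/-- **for an implementer SECTION** `r` (e.g. Rao's Leray-normalised `r_Δ` of a `LocalSplittingDatum`, or the
`ℓ_Y`-normalised one — the normalisation is immaterial here, the Weyl element fixing no Lagrangian): `E h E⁻¹ = J_𝕋⁻¹`
⇒ `r(h) Φ = γ • Γ⁻¹ (𝓕 (Γ Φ))` for some unit `γ`. Companion of `leraySection_deltaLagrangian_apply_eq_conj_leviOpPi`.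
[cite: Weil1964, n° 13 (29), p. 160; MoeglinVignerasWaldspurger1987, Chap. 2 II.1 (A), II.6; Rangarao1993, Lemma 3.2 (3.9), p. 351] -/
theorem leraySection_deltaLagrangian_apply_eq_smul_conj_fourierOpPi
    (hU : ImplementerUniqueUpToScalar (localSchrodinger F N T v)) (r : ImplementerSection (localSchrodinger F N T v))
    (E' : LocalSp F N T v)
    (Γ : SchwartzBruhat (Fin N → v.adicCompletion F) ≃ₗ[ℂ] SchwartzBruhat (Fin N → v.adicCompletion F))
    (hΓ : Implements (localSchrodinger F N T v) (ofSymplectic _ E') Γ) (h : LocalSp F N T v)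
    (hW : E' * h * E'⁻¹ = (transportSp (localGram F N T v) hTv (SymplecticGroup.symJ _ _))⁻¹)
    {m : ℤ} (hm : (adeleAddCharAt F v).HasConductorExp m) :
    ∃ γ : ℂˣ, ∀ Φ : SchwartzBruhat (Fin N → v.adicCompletion F),
      r h Φ = (γ : ℂ) • Γ.symm (fourierOpPi μ (isContinuousNontrivial_adeleAddCharAt F v) hm (Γ Φ)) :=
  implementer_apply_eq_smul_conj_fourierOpPi F N T v μ hTv hU (r.implements h) hΓ hW hm

/-- the section form, opposite orientation: `E h E⁻¹ = J_𝕋` ⇒ `r(h) Φ = γ • Γ⁻¹ (𝓕⁻¹ (Γ Φ))`.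
[cite: Weil1964, n° 13 (29), p. 160; MoeglinVignerasWaldspurger1987, Chap. 2 II.1 (A), II.6] -/
theorem leraySection_deltaLagrangian_apply_eq_smul_conj_fourierOpPi_symm
    (hU : ImplementerUniqueUpToScalar (localSchrodinger F N T v)) (r : ImplementerSection (localSchrodinger F N T v))
    (E' : LocalSp F N T v)
    (Γ : SchwartzBruhat (Fin N → v.adicCompletion F) ≃ₗ[ℂ] SchwartzBruhat (Fin N → v.adicCompletion F))
    (hΓ : Implements (localSchrodinger F N T v) (ofSymplectic _ E') Γ) (h : LocalSp F N T v)
    (hW : E' * h * E'⁻¹ = transportSp (localGram F N T v) hTv (SymplecticGroup.symJ _ _))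
    {m : ℤ} (hm : (adeleAddCharAt F v).HasConductorExp m) :
    ∃ γ : ℂˣ, ∀ Φ : SchwartzBruhat (Fin N → v.adicCompletion F),
      r h Φ = (γ : ℂ) • Γ.symm ((fourierOpPi μ (isContinuousNontrivial_adeleAddCharAt F v) hm).symm (Γ Φ)) :=
  implementer_apply_eq_smul_conj_fourierOpPi_symm F N T v μ hTv hU (r.implements h) hΓ hW hm

/-- the section form of the mixed word `E h E⁻¹ = J_𝕋⁻¹ m(B)`: `r(h) Φ = γ • Γ⁻¹ (𝓕 (leviOpPi (x ↦ B x) (Γ Φ)))`.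
[cite: Weil1964, n° 13 (29), p. 160; MoeglinVignerasWaldspurger1987, Chap. 2 II.1 (A), II.6] -/
theorem leraySection_deltaLagrangian_apply_eq_smul_conj_fourierOpPi_leviOpPi
    (hU : ImplementerUniqueUpToScalar (localSchrodinger F N T v)) (r : ImplementerSection (localSchrodinger F N T v))
    (E' : LocalSp F N T v)
    (Γ : SchwartzBruhat (Fin N → v.adicCompletion F) ≃ₗ[ℂ] SchwartzBruhat (Fin N → v.adicCompletion F))
    (hΓ : Implements (localSchrodinger F N T v) (ofSymplectic _ E') Γ) (h : LocalSp F N T v)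
    (B' : GL (Fin N) (v.adicCompletion F))
    (hW : E' * h * E'⁻¹ = (transportSp (localGram F N T v) hTv (SymplecticGroup.symJ _ _))⁻¹ *
      transportSp (localGram F N T v) hTv (levi B'))
    {m : ℤ} (hm : (adeleAddCharAt F v).HasConductorExp m) :
    ∃ γ : ℂˣ, ∀ Φ : SchwartzBruhat (Fin N → v.adicCompletion F),
      r h Φ = (γ : ℂ) • Γ.symm (fourierOpPi μ (isContinuousNontrivial_adeleAddCharAt F v) hm
        (leviOpPi (glEquiv B') (Γ Φ))) :=
  implementer_apply_eq_smul_conj_fourierOpPi_leviOpPi F N T v μ hTv hU (r.implements h) hΓ B' hW hm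

/-- the section form of the mixed word `E h E⁻¹ = m(B) J_𝕋⁻¹`: `r(h) Φ = γ • Γ⁻¹ (leviOpPi (x ↦ B x) (𝓕 (Γ Φ)))`.
[cite: Weil1964, n° 13 (29), p. 160; MoeglinVignerasWaldspurger1987, Chap. 2 II.1 (A), II.6] -/
theorem leraySection_deltaLagrangian_apply_eq_smul_conj_leviOpPi_fourierOpPi
    (hU : ImplementerUniqueUpToScalar (localSchrodinger F N T v)) (r : ImplementerSection (localSchrodinger F N T v))
    (E' : LocalSp F N T v)
    (Γ : SchwartzBruhat (Fin N → v.adicCompletion F) ≃ₗ[ℂ] SchwartzBruhat (Fin N → v.adicCompletion F))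
    (hΓ : Implements (localSchrodinger F N T v) (ofSymplectic _ E') Γ) (h : LocalSp F N T v)
    (B' : GL (Fin N) (v.adicCompletion F))
    (hW : E' * h * E'⁻¹ = transportSp (localGram F N T v) hTv (levi B') *
      (transportSp (localGram F N T v) hTv (SymplecticGroup.symJ _ _))⁻¹)
    {m : ℤ} (hm : (adeleAddCharAt F v).HasConductorExp m) :
    ∃ γ : ℂˣ, ∀ Φ : SchwartzBruhat (Fin N → v.adicCompletion F),
      r h Φ = (γ : ℂ) • Γ.symm (leviOpPi (glEquiv B')
        (fourierOpPi μ (isContinuousNontrivial_adeleAddCharAt F v) hm (Γ Φ))) :=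
  implementer_apply_eq_smul_conj_leviOpPi_fourierOpPi F N T v μ hTv hU (r.implements h) hΓ B' hW hm

/-! ### §2.1 The Weil-representation form: `ω_D(g) = γ • Γ⁻¹ 𝓕 Γ` when `E ι_v(g) E⁻¹ = J_𝕋⁻¹` -/

section Datum

variable (E : Type) [Field E] [NumberField E] [Algebra F E] [Algebra.IsQuadraticExtension F E] (c : E ≃ₐ[F] E)
  {δ : E} (hcδ : c δ = -δ) (hδ : δ ≠ 0) {d : F} (hd : δ * δ = algebraMap F E d)
  (hT : T.IsSymm) (hTd : IsUnit T.det) {J : Matrix (Fin N) (Fin N) E} (hJ : J = T.map (algebraMap F E))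
  (ψ' : AddChar (v.adicCompletion F) Circle) (hψ' : ψ'.IsContinuousNontrivial)
  (ℓ : Submodule (v.adicCompletion F) ((Fin N → v.adicCompletion F) × (Fin N → v.adicCompletion F)))
  (hℓ : LinearMap.BilinForm.orthogonal (alt (polar (localPairing F N T v))) ℓ = ℓ)

/-- **THE WEIL REPRESENTATION AT A WEYL-TYPE ELEMENT IS A UNIT MULTIPLE OF THE CONJUGATED FOURIER OPERATOR**: for a
local splitting datum `D` (Weil representation `ω_D(g) = β(g)⁻¹ r(ι_v g)`), `Γ` an implementer of `E ∈ Sp(𝕎_v)` and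
`g ∈ U(J)(F_v)` with `E ι_v(g) E⁻¹ = J_𝕋⁻¹`: `ω_D(g) Φ = γ • Γ⁻¹ (𝓕 (Γ Φ))` for some `γ ∈ ℂˣ` (the splitting scalar
`β(g)⁻¹` is absorbed in `γ`). [cite: Weil1964, n° 13 (29), p. 160; MoeglinVignerasWaldspurger1987, Chap. 2 II.1 (A), II.6; Kudla1994, Thm 3.1] -/
theorem LocalSplittingDatum.localOmega_apply_eq_smul_conj_fourierOpPi
    (D : LocalSplittingDatum F E c N hcδ hδ hd T hT hTd hJ v μ ℓ hℓ) (E' : LocalSp F N T v)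
    (Γ : SchwartzBruhat (Fin N → v.adicCompletion F) ≃ₗ[ℂ] SchwartzBruhat (Fin N → v.adicCompletion F))
    (hΓ : Implements (localSchrodinger F N T v) (ofSymplectic _ E') Γ) (g : UnitaryGroup.localPi E c N J v)
    (hW : E' * iota F E c N hcδ hδ hd T hT hJ v g * E'⁻¹ =
      (transportSp (localGram F N T v) hTv (SymplecticGroup.symJ _ _))⁻¹)
    {m : ℤ} (hm : (adeleAddCharAt F v).HasConductorExp m) :
    ∃ γ : ℂˣ, ∀ Φ : SchwartzBruhat (Fin N → v.adicCompletion F),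
      D.localOmega g Φ = (γ : ℂ) • Γ.symm (fourierOpPi μ (isContinuousNontrivial_adeleAddCharAt F v) hm (Γ Φ)) := by
  obtain ⟨γ, hγ⟩ := leraySection_deltaLagrangian_apply_eq_smul_conj_fourierOpPi F N T v μ hTv D.hU D.r E' Γ hΓ
    (iota F E c N hcδ hδ hd T hT hJ v g) hW hm
  refine ⟨(D.beta g)⁻¹ * γ, fun Φ => ?_⟩
  rw [D.localOmega_apply, hγ Φ, Units.smul_def, smul_smul, Units.val_mul]

/-- the Weil-representation form, opposite orientation: `E ι_v(g) E⁻¹ = J_𝕋` ⇒ `ω_D(g) Φ = γ • Γ⁻¹ (𝓕⁻¹ (Γ Φ))`.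
[cite: Weil1964, n° 13 (29), p. 160; MoeglinVignerasWaldspurger1987, Chap. 2 II.1 (A), II.6; Kudla1994, Thm 3.1] -/
theorem LocalSplittingDatum.localOmega_apply_eq_smul_conj_fourierOpPi_symm
    (D : LocalSplittingDatum F E c N hcδ hδ hd T hT hTd hJ v μ ℓ hℓ) (E' : LocalSp F N T v)
    (Γ : SchwartzBruhat (Fin N → v.adicCompletion F) ≃ₗ[ℂ] SchwartzBruhat (Fin N → v.adicCompletion F))
    (hΓ : Implements (localSchrodinger F N T v) (ofSymplectic _ E') Γ) (g : UnitaryGroup.localPi E c N J v)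
    (hW : E' * iota F E c N hcδ hδ hd T hT hJ v g * E'⁻¹ =
      transportSp (localGram F N T v) hTv (SymplecticGroup.symJ _ _))
    {m : ℤ} (hm : (adeleAddCharAt F v).HasConductorExp m) :
    ∃ γ : ℂˣ, ∀ Φ : SchwartzBruhat (Fin N → v.adicCompletion F),
      D.localOmega g Φ = (γ : ℂ) •
        Γ.symm ((fourierOpPi μ (isContinuousNontrivial_adeleAddCharAt F v) hm).symm (Γ Φ)) := by
  obtain ⟨γ, hγ⟩ := leraySection_deltaLagrangian_apply_eq_smul_conj_fourierOpPi_symm F N T v μ hTv D.hU D.r E' Γ hΓ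
    (iota F E c N hcδ hδ hd T hT hJ v g) hW hm
  refine ⟨(D.beta g)⁻¹ * γ, fun Φ => ?_⟩
  rw [D.localOmega_apply, hγ Φ, Units.smul_def, smul_smul, Units.val_mul]

end Datum

end Literature.NumberTheory.GelbartRogawski1991.UnitaryDualPair.LocalSplitting

end
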